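import Summits.CriticalPhenomena.PercolationContinuityZ3.Theorems.FK.FKEdgeCountCLT
import Summits.CriticalPhenomena.PercolationContinuityZ3.Theorems.FK.GibbsOneEdgeEnergy
import HarnessLib

/-!
# THE LIMITING VARIANCE OF THE EDGE-COUNT CLT IS POSITIVE: `σ²(p,q,d,b) ≥ Var X_0 ≥ d · p(1−p)/(p + q(1−p)) > 0`
# for `0 < p < 1` — Newman's CLT for the random-cluster edge count is non-degenerate

Claimed R42 (8)(c) in the cell INBOX at 2026-08-28T13:56:48Z by fkp-10a gen 354 (NEW CLAIM #2 of the gen), addressed to coordinator fk-4 g274 (seated 13:10Z 2026-08-28 by l.8389; R151 l.8390: row FO-10a-g354 [g274, R151] = package g354-newmanclt, its (κ) SPENT by l.8399 — hence a new ruling); lineage row FO-10a-g354x (self-suggested), package g354-cltextras, label PV-A.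
Helper file of the `fk-continuity` build cell (bschramm lane; `--supports stmt-CriticalPhenomena-4575`); builds on
p205010 (kernel theorem, internal audit signed; external expert review pending). No definitions, no named facts, no
sorries; standard axioms. UNCONDITIONAL.

For the coordinate-edge field `X_z = Σ_{i<d} 1{⟨z, z+e_i⟩ open}` of `φ^b_{p,q} = rcLimit d b p q` (`0 ≤ p ≤ 1`,
`q ≥ 1`): all covariances `γ(z) = Cov(X_0, X_z)` are `≥ 0` by FKG, so whenever `γ` is summable the CLT variance
`σ² = Σ_z γ(z)` dominates `γ(0) = Var X_0` (`variance_le_tsum_covariance_coordEdgeCount`); again by FKG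
`Var X_0 ≥ Σ_i Var 1{e_{0,i} open} = Σ_i h_i(1 − h_i)` (`sum_mul_one_sub_le_variance_coordEdgeCount`), and the
finite-energy bounds `π = p/(p+q(1−p)) ≤ h_i = φ^b(e_{0,i} open) ≤ p` (tree: `FKGibbs.div_mul_real_le_real_inter_mem_of_finset`,
`FKGibbs.real_inter_mem_le_mul_of_finset`, Grimmett Thm. (4.17)(b) with (3.3)) give `h_i(1−h_i) ≥ π(1−p)`
(`rcLimit_real_coordEdge_mem_Icc`, `variance_coordEdgeCount_ge`). Consequences:

* `tsum_covariance_coordEdgeCount_ge` — `Σ_z Cov_{φ^b}(X_0, X_z) ≥ d·π·(1−p)` whenever the series is summable;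
* `tsum_covariance_coordEdgeCount_pos_of_lt_rcCriticalProb` — below `p_c(q)` (`d ≥ 2`, `0 < p < p_c(q)`) the CLT of
  `FKEdgeCountCLT` has `σ² > 0`.

## References

* C. M. Newman, *Normal fluctuations and the FKG inequalities*, Comm. Math. Phys. 74 (1980) 119–128, Thm. 2 and
  (13) (the variance `A = Σ_k Cov(X_0, X_k)`). [Newman1980]
* G. Grimmett, *The Random-Cluster Model*, Springer 2006, Thm. (3.1)/(3.8) eq. (3.3) (finite energy), Thm. (4.17)(b).
  [Grimmett2006]
-/

noncomputable section

namespace Summit.CriticalPhenomena.PercolationContinuityZ3.Theorems.FK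

namespace NewmanCLT

open MeasureTheory ProbabilityTheory Complex Finset Filter Topology
open Literature.Probability.Percolation Literature.Probability.LatticeModels Literature.Barriers.CriticalPhenomena
open BoundaryInfluence

variable {d : ℕ} {p q : ℝ}

/-! ### One-edge densities are in `[π, p]` -/

/-- **Finite energy for the box limits**: `p/(p+q(1−p)) ≤ φ^b_{p,q}(e open) ≤ p` for every lattice edge `e`
(`0 ≤ p ≤ 1`, `q ≥ 1`). [cite: Grimmett2006, Thm. (4.17)(b) with eq. (3.3)] -/
theorem rcLimit_real_setOf_mem_mem_Icc (b : Bool) (hp : p ∈ Set.Icc (0 : ℝ) 1) (hq : 1 ≤ q) {e : Sym2 (Site d)}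
    (he : e ∈ (zdGraph d).edgeSet) :
    (rcLimit d b p q).real {ω | e ∈ ω} ∈ Set.Icc (p / (p + q * (1 - p))) p := by
  haveI := isProbabilityMeasure_rcLimit (d := d) b p q
  have hG : FKGibbs d p q (rcLimit d b p q) := (isBoxLimit_rcLimit b hp hq).fkGibbs hp hq
  have hq0 : 0 < q := by linarith
  have hU : DeterminedBy (Set.univ : Set (BondConfig (Site d))) ↑(∅ : Finset (Sym2 (Site d))) := determinedBy_univ _
  have h1 := FKGibbs.div_mul_real_le_real_inter_mem_of_finset hG hp hq0 he ∅ hU (Finset.notMem_empty e)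
  have h2 := FKGibbs.real_inter_mem_le_mul_of_finset hG hp hq0 he ∅ hU (Finset.notMem_empty e)
  rw [Set.univ_inter, probReal_univ, mul_one] at h1 h2
  exact ⟨h1, h2⟩

/-- `t(1 − t) ≥ π(1 − p)` for `t ∈ [π, p]`, `p ≤ 1`. [folklore] -/
theorem mul_one_sub_ge_of_mem_Icc {π t : ℝ} (hπ : 0 ≤ π) (hp1 : p ≤ 1) (ht : t ∈ Set.Icc π p) :
    π * (1 - p) ≤ t * (1 - t) :=
  mul_le_mul ht.1 (by linarith [ht.2]) (by linarith) (hπ.trans ht.1)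

/-! ### `Var X_0 ≥ d · π(1 − p)` -/

/-- The variance of an indicator is `h(1 − h)`, `h = P(A)`. [folklore] -/
theorem variance_indicator_one_eq {Ω : Type*} [MeasurableSpace Ω] (P : Measure Ω) [IsProbabilityMeasure P]
    {A : Set Ω} (hA : MeasurableSet A) :
    Var[A.indicator (1 : Ω → ℝ); P] = P.real A * (1 - P.real A) := by
  have hm : Measurable (A.indicator (1 : Ω → ℝ)) := measurable_const.indicator hA
  rw [← covariance_self hm.aemeasurable, covariance_indicator_one_eq P hA hA, Set.inter_self]
  ring

/-- **`Var_{φ^b}(X_0) ≥ Σ_i h_i(1 − h_i) ≥ d · π(1 − p)`**, `π = p/(p+q(1−p))`: the cross covariances of the one-edge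
indicators are nonnegative (FKG) and each one-edge density lies in `[π, p]`.
[cite: Grimmett2006, Thm. (4.17)(b); Newman1980, (10)] -/
theorem variance_coordEdgeCount_ge (b : Bool) (hp : p ∈ Set.Icc (0 : ℝ) 1) (hq : 1 ≤ q) :
    (d : ℝ) * (p / (p + q * (1 - p)) * (1 - p)) ≤
      Var[fun ω => ∑ i : Fin d, ({ω' : BondConfig (Site d) | s((0 : Site d), 0 + Pi.single i 1) ∈ ω'}).indicator
        (1 : BondConfig (Site d) → ℝ) ω; rcLimit d b p q] := by
  haveI := isProbabilityMeasure_rcLimit (d := d) b p q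
  have hμ : IsPositivelyAssociated (rcLimit d b p q) := isPositivelyAssociated_rcLimit b hp hq
  have hmeas : ∀ i : Fin d, MeasurableSet {ω' : BondConfig (Site d) | s((0 : Site d), 0 + Pi.single i 1) ∈ ω'} :=
    fun i => measurableSet_of_isLocalEvent_holds (isLocalEvent_setOf_mem _)
  have hm : ∀ i : Fin d, MemLp (({ω' : BondConfig (Site d) | s((0 : Site d), 0 + Pi.single i 1) ∈ ω'}).indicator
      (1 : BondConfig (Site d) → ℝ)) 2 (rcLimit d b p q) := fun i =>
    memLp_of_abs_le (measurable_indicator_coordEdge 0 i) (fun ω => abs_indicator_one_le_one _ ω) 2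
  rw [← covariance_self (measurable_coordEdgeCount 0).aemeasurable,
    covariance_fun_sum_fun_sum' (fun i _ => hm i) (fun j _ => hm j)]
  -- keep the diagonal
  have hdiag : ∀ i ∈ (Finset.univ : Finset (Fin d)),
      cov[({ω' : BondConfig (Site d) | s((0 : Site d), 0 + Pi.single i 1) ∈ ω'}).indicator (1 : BondConfig (Site d) → ℝ),
        ({ω' : BondConfig (Site d) | s((0 : Site d), 0 + Pi.single i 1) ∈ ω'}).indicator (1 : BondConfig (Site d) → ℝ);
        rcLimit d b p q] ≤
      ∑ j : Fin d, cov[({ω' : BondConfig (Site d) | s((0 : Site d), 0 + Pi.single i 1) ∈ ω'}).indicator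
        (1 : BondConfig (Site d) → ℝ), ({ω' : BondConfig (Site d) | s((0 : Site d), 0 + Pi.single j 1) ∈ ω'}).indicator
        (1 : BondConfig (Site d) → ℝ); rcLimit d b p q] := fun i hi =>
    Finset.single_le_sum (f := fun j => cov[({ω' : BondConfig (Site d) | s((0 : Site d), 0 + Pi.single i 1) ∈ ω'}).indicator
        (1 : BondConfig (Site d) → ℝ), ({ω' : BondConfig (Site d) | s((0 : Site d), 0 + Pi.single j 1) ∈ ω'}).indicator
        (1 : BondConfig (Site d) → ℝ); rcLimit d b p q])
      (fun j _ => covariance_nonneg_of_monotone hμ (monotone_indicator_coordEdge 0 i) (monotone_indicator_coordEdge 0 j)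
        (measurable_indicator_coordEdge 0 i) (measurable_indicator_coordEdge 0 j) ⟨1, abs_indicator_one_le_one _⟩
        ⟨1, abs_indicator_one_le_one _⟩) hi
  refine le_trans ?_ (Finset.sum_le_sum hdiag)
  -- each diagonal term is `h_i(1 − h_i) ≥ π(1−p)`
  have hterm : ∀ i : Fin d, p / (p + q * (1 - p)) * (1 - p) ≤
      cov[({ω' : BondConfig (Site d) | s((0 : Site d), 0 + Pi.single i 1) ∈ ω'}).indicator (1 : BondConfig (Site d) → ℝ),
        ({ω' : BondConfig (Site d) | s((0 : Site d), 0 + Pi.single i 1) ∈ ω'}).indicator (1 : BondConfig (Site d) → ℝ);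
        rcLimit d b p q] := fun i => by
    have hmi : Measurable (({ω' : BondConfig (Site d) | s((0 : Site d), 0 + Pi.single i 1) ∈ ω'}).indicator
        (1 : BondConfig (Site d) → ℝ)) := measurable_const.indicator (hmeas i)
    rw [covariance_self hmi.aemeasurable, variance_indicator_one_eq _ (hmeas i)]
    exact mul_one_sub_ge_of_mem_Icc (ratio_mem_Icc hp hq).1 hp.2
      (rcLimit_real_setOf_mem_mem_Icc b hp hq (coordEdge_mem_edgeSet 0 i))
  calc (d : ℝ) * (p / (p + q * (1 - p)) * (1 - p)) = ∑ _i : Fin d, p / (p + q * (1 - p)) * (1 - p) := by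
        rw [Finset.sum_const, Finset.card_univ, Fintype.card_fin, nsmul_eq_mul]
    _ ≤ _ := Finset.sum_le_sum fun i _ => hterm i

/-! ### `σ² ≥ Var X_0` and positivity -/

/-- **`Σ_z Cov_{φ^b}(X_0, X_z) ≥ Var_{φ^b} X_0`** whenever the covariance series is summable: all its terms are
nonnegative by FKG and the `z = 0` term is the variance. [cite: Newman1980, (10) and (13)] -/
theorem variance_le_tsum_covariance_coordEdgeCount (b : Bool) (hp : p ∈ Set.Icc (0 : ℝ) 1) (hq : 1 ≤ q)
    (hs : Summable fun z : Site d => cov[fun ω => ∑ i : Fin d,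
        ({ω' : BondConfig (Site d) | s((0 : Site d), 0 + Pi.single i 1) ∈ ω'}).indicator (1 : BondConfig (Site d) → ℝ) ω,
      fun ω => ∑ j : Fin d, ({ω' : BondConfig (Site d) | s(z, z + Pi.single j 1) ∈ ω'}).indicator
        (1 : BondConfig (Site d) → ℝ) ω; rcLimit d b p q]) :
    Var[fun ω => ∑ i : Fin d, ({ω' : BondConfig (Site d) | s((0 : Site d), 0 + Pi.single i 1) ∈ ω'}).indicator
        (1 : BondConfig (Site d) → ℝ) ω; rcLimit d b p q] ≤
      ∑' z : Site d, cov[fun ω => ∑ i : Fin d,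
        ({ω' : BondConfig (Site d) | s((0 : Site d), 0 + Pi.single i 1) ∈ ω'}).indicator (1 : BondConfig (Site d) → ℝ) ω,
        fun ω => ∑ j : Fin d, ({ω' : BondConfig (Site d) | s(z, z + Pi.single j 1) ∈ ω'}).indicator
          (1 : BondConfig (Site d) → ℝ) ω; rcLimit d b p q] := by
  haveI := isProbabilityMeasure_rcLimit (d := d) b p q
  have hμ : IsPositivelyAssociated (rcLimit d b p q) := isPositivelyAssociated_rcLimit b hp hq
  have h0 := hs.le_tsum (0 : Site d) fun z _ => covariance_nonneg_of_monotone hμ (monotone_coordEdgeCount 0)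
    (monotone_coordEdgeCount z) (measurable_coordEdgeCount 0) (measurable_coordEdgeCount z)
    ⟨d, abs_coordEdgeCount_le 0⟩ ⟨d, abs_coordEdgeCount_le z⟩
  refine le_trans (le_of_eq ?_) h0
  rw [← covariance_self (measurable_coordEdgeCount 0).aemeasurable]

/-- **Lower bound on the CLT variance**: `Σ_z Cov_{φ^b}(X_0, X_z) ≥ d · p(1−p)/(p+q(1−p))` whenever the series is
summable (`0 ≤ p ≤ 1`, `q ≥ 1`). [cite: Newman1980, (13); Grimmett2006, Thm. (4.17)(b)] -/
theorem tsum_covariance_coordEdgeCount_ge (b : Bool) (hp : p ∈ Set.Icc (0 : ℝ) 1) (hq : 1 ≤ q)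
    (hs : Summable fun z : Site d => cov[fun ω => ∑ i : Fin d,
        ({ω' : BondConfig (Site d) | s((0 : Site d), 0 + Pi.single i 1) ∈ ω'}).indicator (1 : BondConfig (Site d) → ℝ) ω,
      fun ω => ∑ j : Fin d, ({ω' : BondConfig (Site d) | s(z, z + Pi.single j 1) ∈ ω'}).indicator
        (1 : BondConfig (Site d) → ℝ) ω; rcLimit d b p q]) :
    (d : ℝ) * (p / (p + q * (1 - p)) * (1 - p)) ≤
      ∑' z : Site d, cov[fun ω => ∑ i : Fin d,
        ({ω' : BondConfig (Site d) | s((0 : Site d), 0 + Pi.single i 1) ∈ ω'}).indicator (1 : BondConfig (Site d) → ℝ) ω,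
        fun ω => ∑ j : Fin d, ({ω' : BondConfig (Site d) | s(z, z + Pi.single j 1) ∈ ω'}).indicator
          (1 : BondConfig (Site d) → ℝ) ω; rcLimit d b p q] :=
  (variance_coordEdgeCount_ge b hp hq).trans (variance_le_tsum_covariance_coordEdgeCount b hp hq hs)

/-- **Newman's CLT for the edge count of `φ^b_{p,q}` below `p_c(q)` is non-degenerate**: for `d ≥ 2`, `q ≥ 1`,
`0 < p < p_c(q)` the limiting variance `σ² = Σ_z Cov_{φ^b}(X_0, X_z)` of `FKEdgeCountCLT` satisfies
`σ² ≥ d · p(1−p)/(p+q(1−p)) > 0`. [cite: Newman1980, Thm. 2 and (13); Grimmett2006, Thm. (4.17)(b)] -/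
theorem tsum_covariance_coordEdgeCount_pos_of_lt_rcCriticalProb (hd : 2 ≤ d) (hq : 1 ≤ q) (hp0 : 0 < p)
    (hpc : p < rcCriticalProb d q) (b : Bool) :
    0 < ∑' z : Site d, cov[fun ω => ∑ i : Fin d,
        ({ω' : BondConfig (Site d) | s((0 : Site d), 0 + Pi.single i 1) ∈ ω'}).indicator (1 : BondConfig (Site d) → ℝ) ω,
        fun ω => ∑ j : Fin d, ({ω' : BondConfig (Site d) | s(z, z + Pi.single j 1) ∈ ω'}).indicator
          (1 : BondConfig (Site d) → ℝ) ω; rcLimit d b p q] := by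
  have hp1 : p < 1 := hpc.trans (rcCriticalProb_lt_one hd hq)
  have hp : p ∈ Set.Icc (0 : ℝ) 1 := ⟨hp0.le, hp1.le⟩
  refine lt_of_lt_of_le ?_ (tsum_covariance_coordEdgeCount_ge b hp hq (summable_covariance_coordEdgeCount hd hq hp0.le hpc b))
  have hden : 0 < p + q * (1 - p) := by nlinarith
  have hd0 : (0 : ℝ) < d := by exact_mod_cast (show 0 < d by omega)
  have hπ : 0 < p / (p + q * (1 - p)) := div_pos hp0 hden
  have h1p : 0 < 1 - p := by linarith
  positivity

end NewmanCLT

end Summit.CriticalPhenomena.PercolationContinuityZ3.Theorems.FK
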